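import Literature.MathematicalPhysics.QuantumFieldTheory.Balaban1983to89.B9GeoLemma21KLevelV1
import Literature.MathematicalPhysics.QuantumFieldTheory.Balaban1983to89.B9GeoNbrCountKLevelV1
import Literature.MathematicalPhysics.QuantumFieldTheory.Balaban1983to89.B9GeoNormsKLevelModelSignsV1
import Literature.MathematicalPhysics.QuantumFieldTheory.Balaban1983to89.B9RowSum261DefiniteFaces
import Literature.MathematicalPhysics.QuantumFieldTheory.Balaban1983to89.B9Thm312WholeLeft
import Literature.MathematicalPhysics.QuantumFieldTheory.Balaban1983to89.B9RWSumsCompleteGeo9YNbr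
import HarnessLib

/-!
# Route `UnitScaleTilt`, crux «MinimiserStabilityRegPr» (stmt-QuantumFields-19200, v10 stub EX `stub_existenceMinimalOrbit`, route (α)) and the deciding
# «FluctuationComparisonRegPrIntL» (stmt-QuantumFields-20520, via T8 ⇐ {H, EX}) — OWNER RULING g25-№2 §3, item (N06-3-6):
# **THE GEOMETRY ROWS OF THE N06(d = 3) KNIT, BY NAME, AT THE d = 3 READING OF def-Y's k-LEVEL GEOMETRY**

Cell `ym3-torus` (HUMAN RULING D-0037: YM₃ on T³ is ladder rung R3 — NOT the Clay problem), width seat `ym-ust-20520-w3` g2; count-neutral helper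
(`--supports stmt-QuantumFields-19200 --as helper`); def-free (0 `def`, 0 `sorry`, standard axioms).

THE READING (posted on the cell bus 2026-08-28T01:56Z before typing, for ★w4-19200's (S2)∕(S3) instance and ★w5-20520's transport to align).  The N06(d = 3)
text of record (RULING g25-№2 §1) is Track A's `B9.Thm313Printed` ∕ `B9.Thm312Printed` read at the T³ member index; the geometry letter is
**`geo i := B9GeoNormsKLevelV1.geo9K i` for `i : B6KLevelCensusIndexV1.KIdx 2 ℓ hd hL b₀ b₁`** (`hd : 1 ≤ 2 + 1`, `hL : Odd (ℓ+1) ∧ 1 < ℓ+1`) — def-Y's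
k-level V1 index AT d + 1 = 3 (`geo9Y x = geo9K x.toKIdx` is the same reading with the `M⋆` floor) — the T³ member `(F, n, K)`, `F = ⟨ℓ+1, hL, m, hm⟩ : T3Family`,
entering through ★ym3-torus-p1's port dictionary `F.P K = PV 2 ℓ F.m K hd hL` (`UnitScaleTiltProp8FlatPortChart`), `i.m = F.m`, `i.K = K`, `i.k = K − n`, `i.D` the
pure-small-field family (every `Ω_j` the torus), `i.w` the (3.41) weights in `GlobalBand b₀ b₁ i.cf` — the index ★p1's P2 port lands on
(`FlatPortKernelRowsL0.kernelRowsAt_of_adm22`).  The member map itself is (S2)'s (★w4-19200); nothing of it is fixed here.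

WHAT THIS FILE PROVES.  Every geometry binder of the two N06 capstones `B9Thm312WholeLeafCompletePairMBZ.thm312Printed_completePairMBZ` ∕
`B9Thm313WholeLeafCompletePairMBZ.thm313Printed_completePairMBZ` that is a property of `geo` ALONE is def-Y's ∕ n06-i's GENERIC theorem (any `d`) instantiated —
stated once generically over `KIdx d ℓ hd hL b₀ b₁` (§1) and bundled at `d := 2` (§2, ★ `t3_geometry_rows`):
* `hgeo`  — `geoOK_geo9K : GeoOK (geo9K i)` ((2.54) triangle, symmetry, `d ≥ 0`, `Lʲη > 0`; twin of the T⁴ record's `N06AtRecord11ObligationsPins3.geoOK_geo9Y`);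
* `hrow`  — `B9GeoLemma21KLevelV1.rowSum261_geo9K` ([4] Lemma 2.1 (2.61) with a generic constant at every rate under an `M`-threshold) — cited, not restated;
* the level gap (2.60) — `levelGap_geo9K_one` ∕ `ineq260_geo9K` — cited inside `lemma21AboveG_geo9K`;
* `hL21` — `lemma21AboveG_geo9K : ∀ δ > 0, ∃ ML′ c′, Lemma21AboveG geo9K (fun _ => 1) H δ α ML′ c′` (the KIdx twin of `B9Thm312WholeFacesY.lemma21AboveG_geo9Y`,
  from `B9RowSum261DefiniteFaces.exists_lemma21Above_of_rowSum261`);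
* `hnbr`∕`hmult`-type counts — `B9GeoNbrCountKLevelV1.exists_card_nbr_geo9K_le` (radius `r`, member-uniform `mN` above an `M`-threshold) — cited;
* the sign facts `S` — `B9GeoNormsKLevelModelSignsV1.modelSignsOn_geo9K` — cited;
* `hL1`∕`hLle` — `geo9K_one_le_L`, `geo9K_L_le : (geo9K i).L ≤ ℓ + 1` (so `Lc := ℓ + 1`), `hη` — `geo9K_eta_pos`;
* `hCL` — n06-i's `B9RWSumsCompleteGeo9YNbr.len_le_of_dist_lt_M_geo9K` (`ℓ(c) ≤ L·ℓ(c′)` whenever `d(c, c′) < M`; with `eight_le_M_geo9K`: every capstone radius `r ≤ 8` qualifies) — cited;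
* `hLc` — `B9RWSumsCompleteGeo9YNbr.one_le_L_nat` — cited.
LOCATED (numbers): the V1 index carries `KIdx.hℓ : 4 ≤ ℓ` (block size L ≥ 5; L = 3 is sub-gap (P2-L3)), `hk2 : 2 ≤ k` (height K − n ≥ 2), `hM8 : 8 ≤ M_h = Lᵃ`,
`hR2 : 2L² ≤ R`, `hP5 : 5 ≤ P′` — the T³ instance inherits them.  The length-comparability row `hCL` (`dist a a′ ≤ r → len a ≤ C_L·len a′`) is n06-i's
`len_le_of_dist_lt_M_geo9K` (`C_L = L` for `d(a, a′) < M`, `M ≥ 8`), cited in the bundle; for radii `r ≥ 8` (e.g. `r = ℓ + 4` at `ℓ ≥ 4`) the instance adds the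
one-line `M`-threshold `r < M` (`M = L·M_h ≥ 5·8`).  HONEST FRAMING: bookkeeping over landed generic theorems; nothing of [Balaban1984PropagatorsII]∕[Balaban1985BackgroundPropagators] is
asserted; no claim on a stub, the crux, V3∕R3 or the gap; YM₃ on T³ = rung R3 (RECORD†), not Clay.

References: T. Bałaban, CMP **96** (1984) 223–250 [Balaban1984PropagatorsII] ((2.1)–(2.2) p.224, (2.46) p.231, (2.54), (2.59) p.233, Lemma 2.1 (2.60)–(2.61) p.234);
CMP **99** (1985) 389–434 [Balaban1985BackgroundPropagators] (Sect. A (3.39)–(3.41) p.397, (3.43)–(3.47) p.398).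
-/

set_option autoImplicit false

noncomputable section

namespace Summit.QuantumFields.YangMills.Theorems.Prop7SectET3Geometry

open Literature.MathematicalPhysics.QuantumFieldTheory.Balaban1983to89
open Literature.MathematicalPhysics.QuantumFieldTheory.Balaban1983to89.B6KLevelCensusIndexV1 (KIdx)
open Literature.MathematicalPhysics.QuantumFieldTheory.Balaban1983to89.B9GeoNormsKLevelV1 (geo9K geo9K_dist_nonneg)
open Literature.MathematicalPhysics.QuantumFieldTheory.Balaban1983to89.B9GeoLemma21KLevelV1
  (geo9K_dist_triangle geo9K_dist_comm geo9K_len_pos geo9K_one_le_L geo9K_eta_pos distOK_geo9K levelGap_geo9K_one ineq260_geo9K rowSum261_geo9K)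
open Literature.MathematicalPhysics.QuantumFieldTheory.Balaban1983to89.B9GeoNbrCountKLevelV1 (exists_card_nbr_geo9K_le)
open Literature.MathematicalPhysics.QuantumFieldTheory.Balaban1983to89.B9GeoNormsKLevelModelSignsV1 (modelSignsOn_geo9K)
open Literature.MathematicalPhysics.QuantumFieldTheory.Balaban1983to89.B9Thm312Whole (GeoOK)
open Literature.MathematicalPhysics.QuantumFieldTheory.Balaban1983to89.B9Thm312WholeLeft (Lemma21AboveG lemma21AboveG_of_above)
open Literature.MathematicalPhysics.QuantumFieldTheory.Balaban1983to89.B9RowSum261DefiniteFaces (exists_lemma21Above_of_rowSum261)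
open Literature.MathematicalPhysics.QuantumFieldTheory.Balaban1983to89.B9Ineq349Whole (RowSum261 LevelGap DistOK)
open Literature.MathematicalPhysics.QuantumFieldTheory.Balaban1983to89.B9RWSumsReadsNbr (nbr)
open Literature.MathematicalPhysics.QuantumFieldTheory.Balaban1983to89.B9FromB6ModelSignsOn (ModelSignsOn)
open Literature.MathematicalPhysics.QuantumFieldTheory.Balaban1983to89.B9RWSumsCompleteGeo9YNbr (one_le_L_nat eight_le_M_geo9K len_le_of_dist_lt_M_geo9K)

/-! ## §1 The rows at def-Y's k-level geometry `geo9K`, any dimension parameter `d` (d + 1 spatial dimensions) -/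

section Generic

variable {d ℓ : ℕ} {hd : 1 ≤ d + 1} {hL : Odd (ℓ + 1) ∧ 1 < ℓ + 1} {b₀ b₁ : ℝ}

/-- **`hgeo` — `GeoOK (geo9K i)`**: `d` is a pseudo-metric on the index bonds ((2.54) triangle, symmetry, `d ≥ 0`) and `Lʲη > 0`, at every member of
def-Y's k-level V1 index; the KIdx twin of the T⁴ record's `geoOK_geo9Y`. [cite: Balaban1984PropagatorsII, (2.46) p.231, (2.54) p.233] -/
theorem geoOK_geo9K (i : KIdx d ℓ hd hL b₀ b₁) : GeoOK (geo9K i) :=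
  ⟨geo9K_dist_triangle i, geo9K_dist_comm i, geo9K_dist_nonneg i, geo9K_len_pos i⟩

/-- **`hLle` — the block size letter**: `(geo9K i).L = ℓ + 1 ≤ ℓ + 1` (so the capstones' `Lc := ℓ + 1`). [cite: Balaban1984PropagatorsII, (2.1) p.224 (bookkeeping)] -/
theorem geo9K_L_le (i : KIdx d ℓ hd hL b₀ b₁) : (geo9K i).L ≤ ((ℓ + 1 : ℕ) : ℝ) := le_rfl

/-- **`hL21` — `Lemma21AboveG` AT def-Y's k-LEVEL INDEX** (the KIdx twin of `B9Thm312WholeFacesY.lemma21AboveG_geo9Y`): for every weight exponent `0 < α < 1`,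
every side predicate `H` and every rate `δ > 0` there are `M_L′, c′` with [4] (2.60) at rate `αδ`, (2.61) at rate `(1 − α)δ` with constant `c′`, and
`4·log L ≤ α·δ·1·M` above `M_L′` — from the generic row sum `rowSum261_geo9K` and the level gap `levelGap_geo9K_one` by n06-h's
`exists_lemma21Above_of_rowSum261`. [cite: Balaban1984PropagatorsII, Lemma 2.1 (2.60)–(2.61) p.234, (2.59) p.233] -/
theorem lemma21AboveG_geo9K [∀ i : KIdx d ℓ hd hL b₀ b₁, Fintype (geo9K i).Site] (H : KIdx d ℓ hd hL b₀ b₁ → Prop) {α : ℝ} (hα0 : 0 < α) (hα1 : α < 1) :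
    ∀ δ : ℝ, 0 < δ → ∃ ML' c' : ℝ,
      Lemma21AboveG (geo9K (d := d) (ℓ := ℓ) (hd := hd) (hL := hL) (b₀ := b₀) (b₁ := b₁)) (fun _ => (1 : ℝ)) H δ α ML' c' := by
  intro δ hδ
  obtain ⟨dd, ML, h⟩ := exists_lemma21Above_of_rowSum261 (geo := geo9K (d := d) (ℓ := ℓ) (hd := hd) (hL := hL) (b₀ := b₀) (b₁ := b₁))
    one_pos levelGap_geo9K_one rowSum261_geo9K (L := ((ℓ + 1 : ℕ) : ℝ)) (fun i => geo9K_one_le_L i) (fun i => geo9K_L_le i) H hα0 hα1 hδ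
  exact ⟨ML, _, lemma21AboveG_of_above dd h⟩

end Generic

/-! ## §2 ★ The bundle at d + 1 = 3: the geometry rows of the N06(d = 3) knit, by name -/

section T3

variable {ℓ : ℕ} {hd : 1 ≤ 2 + 1} {hL : Odd (ℓ + 1) ∧ 1 < ℓ + 1} {b₀ b₁ : ℝ}

/-- ★ **THE GEOMETRY ROWS OF THE N06(d = 3) KNIT AT THE T³ READING `geo := geo9K (d := 2)`** — in the binder shapes of `thm312Printed_completePairMBZ` ∕
`thm313Printed_completePairMBZ`: `hgeo` (`GeoOK`), the sign facts `S` (`ModelSignsOn … (·.isRight = true)`), `hL1`∕`hLle` with `Lc := ℓ + 1`, `hη`, `DistOK`,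
the level gap (2.60) at `R₀ = 1`, `hrow` (`RowSum261`: (2.61) at every rate `κ > 0` with a generic constant above `M_L(κ)`), `hL21` (`Lemma21AboveG` at every
`0 < α < 1`, `H`, `δ > 0`), the neighbourhood count `hnbr` at every radius (member-uniform `mN` above `M_L`), `hCL` (lengths comparable within distance `< M`, `C_L = L`) and `8 ≤ M`.  All by def-Y's ∕ n06-i's ∕ n06-h's generic
theorems at `d := 2`; the member map `(F, n, K) ↦ KIdx 2 ℓ …` is the instance's ((S2)).
[cite: Balaban1984PropagatorsII, (2.46) p.231, (2.54), (2.59) p.233, Lemma 2.1 (2.60)–(2.61) p.234; Balaban1985BackgroundPropagators, Sect. A (3.39)–(3.41) p.397] -/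
theorem t3_geometry_rows [∀ i : KIdx 2 ℓ hd hL b₀ b₁, Fintype (geo9K i).Site] :
    (∀ i : KIdx 2 ℓ hd hL b₀ b₁, GeoOK (geo9K i)) ∧
    (∀ i : KIdx 2 ℓ hd hL b₀ b₁, ModelSignsOn (geo9K i) (fun lam => lam.isRight = true)) ∧
    (∀ i : KIdx 2 ℓ hd hL b₀ b₁, 1 ≤ (geo9K i).L ∧ (geo9K i).L ≤ ((ℓ + 1 : ℕ) : ℝ) ∧ 0 < (geo9K i).eta) ∧
    (∀ i : KIdx 2 ℓ hd hL b₀ b₁, DistOK (geo9K i)) ∧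
    LevelGap (geo9K (d := 2) (ℓ := ℓ) (hd := hd) (hL := hL) (b₀ := b₀) (b₁ := b₁)) 1 ∧
    RowSum261 (geo9K (d := 2) (ℓ := ℓ) (hd := hd) (hL := hL) (b₀ := b₀) (b₁ := b₁)) ∧
    (∀ (H : KIdx 2 ℓ hd hL b₀ b₁ → Prop) (α : ℝ), 0 < α → α < 1 → ∀ δ : ℝ, 0 < δ → ∃ ML' c' : ℝ,
      Lemma21AboveG (geo9K (d := 2) (ℓ := ℓ) (hd := hd) (hL := hL) (b₀ := b₀) (b₁ := b₁)) (fun _ => (1 : ℝ)) H δ α ML' c') ∧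
    (∀ r : ℝ, ∃ ML : ℝ, ∃ mN : ℕ, ∀ i : KIdx 2 ℓ hd hL b₀ b₁, ML ≤ (geo9K i).M → ∀ y : (geo9K i).Site, (nbr (geo9K i) r y).card ≤ mN) ∧
    (∀ (i : KIdx 2 ℓ hd hL b₀ b₁) (c c' : (geo9K i).Site), (geo9K i).dist c c' < (geo9K i).M →
      (geo9K i).len c ≤ ((ℓ + 1 : ℕ) : ℝ) * (geo9K i).len c') ∧
    (∀ i : KIdx 2 ℓ hd hL b₀ b₁, (8 : ℝ) ≤ (geo9K i).M) := by
  refine ⟨fun i => geoOK_geo9K i, fun i => modelSignsOn_geo9K i, fun i => ⟨geo9K_one_le_L i, geo9K_L_le i, geo9K_eta_pos i⟩, fun i => distOK_geo9K i,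
    levelGap_geo9K_one, rowSum261_geo9K, fun H α hα0 hα1 => lemma21AboveG_geo9K H hα0 hα1, fun r => ?_,
    fun i c c' h => len_le_of_dist_lt_M_geo9K i h, fun i => eight_le_M_geo9K i⟩
  obtain ⟨ML, mN, h⟩ := exists_card_nbr_geo9K_le (d := 2) (ℓ := ℓ) (hd := hd) (hL := hL) (b₀ := b₀) (b₁ := b₁) r
  exact ⟨ML, mN, fun i hM y => h i hM y⟩

end T3

end Summit.QuantumFields.YangMills.Theorems.Prop7SectET3Geometry

end
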